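import Summits.NavierStokesRegularity.NavierStokesRegularity.Theses.TypeILiouville
import Summits.NavierStokesRegularity.NavierStokesRegularity.Theses.SymmetryModuliCount
import Summits.NavierStokesRegularity.NavierStokesRegularity.Theorems.SymmetryModuliCountLiouvilleKillsTypeI
import Summits.NavierStokesRegularity.NavierStokesRegularity.Theorems.TypeILiouvilleTypeIliouvilleLPersistentRegime
import HarnessLib

/-!
# Crux `TypeIliouvilleL` (stmt-NavierStokesRegularity-10661): load-bearing certificate

Route `TypeILiouville` decides Clay (A) through
`closes : TypeIliouvilleNoTypeII → TypeIliouvilleL → TypeIliouvilleLKillsTypeI → Assembly →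
NavierStokesRegularity`, and the KNSS Liouville conjecture (L) = `TypeIliouvilleL` enters that chain
ONLY as the antecedent of `TypeIliouvilleLKillsTypeI` ((L) kills Type-I blow-up).

The crux skeleton (line `registered`, cycles 1–3) split (L) losslessly into
* L' = `stub_typeIAncientLiouville_knssGauge`, VERBATIM the item
  `Theses.SymmetryModuliCount.TypeIAncientLiouville` (stmt-NavierStokesRegularity-4050: Type-I Liouville
  in the KNSS/Oseen gauge), and
* S3 = `stub_persistent_backward_L3_decay` (persistent regime), kernel-checked equivalent to (L) on the
  non-Type-I class and containing the bounded steady Liouville problem in `ℝ³`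
  (`TypeIliouvilleL_iff_knssGauge_and_persistentL3`, `steady_bounded_const_of_persistentL3`).

This file records, kernel-checked, that **only L' is load-bearing for the summit via this route**: the
tree PROVES `Theses.SymmetryModuliCount.LiouvilleKillsTypeI`
(`symmetryModuliCount_liouvilleKillsTypeI_proof`: L' ⟹ a Leray–Hopf classical solution from a rapidly
decaying datum with the Type-I rate extends past `T`; KNSS 2009 §6 Prop. 6.1 + Lemma 6.1), hence

* `typeIliouvilleLKillsTypeI_consequent_of_typeIAncientLiouville` — the consequent of the route's support
  item `TypeIliouvilleLKillsTypeI` already follows from L' (no persistent half needed);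
* `typeIliouvilleThesis_of_noTypeII_of_typeIAncientLiouville` — thesis X (`TypeIliouvilleThesis`, no
  blow-up) from crux #2 `TypeIliouvilleNoTypeII` and L';
* `navierStokesRegularity_of_noTypeII_of_typeIAncientLiouville` — the route's conclusion from crux #2
  and L' alone (through the proved `Assembly_holds`);
* `navierStokesRegularity_of_noTypeII_of_stub_typeIAncientLiouville_knssGauge` — the same with the
  registered stub signature written out (it is L' by `Iff.rfl`);
* `navierStokesRegularity_of_noTypeII_of_TypeIliouvilleL` — for comparison, the route's own chain with
  its proved items discharged; it factors through L' (`typeIAncientLiouville_knssGauge_of_TypeIliouvilleL`).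

Consequence for the planners (D-0014): crux #3 can be re-based on stmt-4050 without loss for the
summit; S3 (the half of (L) that is "open even in the steady-state case", KNSS 2009 p. 3) is carried by
this route but not consumed by it.
-/

-- the problem directory repeats the summit name (D-0017); core's `dupNamespace` linter fires
set_option linter.dupNamespace false

noncomputable section

namespace Summit.NavierStokesRegularity.NavierStokesRegularity.Theorems

open MeasureTheory Set Function Filter
open Literature.Analysis Literature.Analysis.FluidPDE
open Summit.NavierStokesRegularity.NavierStokesRegularity.Theses

/-- **L' already kills Type-I blow-up in the route's maximal-solution form.** Assuming the Type-I
Liouville statement L' in the KNSS gauge (item `SymmetryModuliCount.TypeIAncientLiouville`,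
stmt-NavierStokesRegularity-4050), a maximal smooth solution with finite lifespan `T` which is
Leray–Hopf from a rapidly decaying datum is not Type I at `T`: otherwise the proved
`symmetryModuliCount_liouvilleKillsTypeI_proof` extends it past `T`, contradicting maximality. This is
the consequent of the route's support item `TypeIliouvilleLKillsTypeI` with its antecedent (L) weakened
to L'. [cite: KochNadirashviliSereginSverak2009, §6 Prop. 6.1 and Lemma 6.1 (arXiv:0709.3599 p. 11)] -/
theorem typeIliouvilleLKillsTypeI_consequent_of_typeIAncientLiouville
    (hX : SymmetryModuliCount.TypeIAncientLiouville) :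
    ∀ (ν T : ℝ), 0 < ν → 0 < T →
    ∀ (u : ℝ → EuclideanSpace ℝ (Fin 3) → EuclideanSpace ℝ (Fin 3))
      (p : ℝ → EuclideanSpace ℝ (Fin 3) → ℝ),
    IsMaximalSmoothSolution ν 0 u p T → IsLerayHopfOn T ν 0 (u 0) u →
    HasRapidSpatialDecay (u 0) → ¬ IsTypeIBlowup u T := by
  intro ν T hν hT u p hmax hLH hdec hI
  exact hmax.2 (symmetryModuliCount_liouvilleKillsTypeI_proof hX ν T hν hT u p hmax.1 hLH hdec hI)

/-- **Thesis X of the route from crux #2 and L' alone.** `TypeIliouvilleThesis` (no first singular time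
for Leray–Hopf classical solutions from rapidly decaying data) follows from `TypeIliouvilleNoTypeII`
(a maximal solution blows up at the Type-I rate) and L' (stmt-4050): a solution that does not extend
is maximal, hence Type I by #2, and not Type I by
`typeIliouvilleLKillsTypeI_consequent_of_typeIAncientLiouville` — contradiction. [cite: KochNadirashviliSereginSverak2009, §1 conjecture (L) and §6 (arXiv:0709.3599)] -/
theorem typeIliouvilleThesis_of_noTypeII_of_typeIAncientLiouville : Summit.NavierStokesRegularity.NavierStokesRegularity.Theses.TypeILiouville.TypeIliouvilleNoTypeII → Summit.NavierStokesRegularity.NavierStokesRegularity.Theses.SymmetryModuliCount.TypeIAncientLiouville → Summit.NavierStokesRegularity.NavierStokesRegularity.Theses.TypeILiouville.TypeIliouvilleThesis := by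
  intro hII hX ν T hν hT u p hcl hLH hdec
  by_contra hext
  have hmax : IsMaximalSmoothSolution ν 0 u p T := ⟨hcl, hext⟩
  exact typeIliouvilleLKillsTypeI_consequent_of_typeIAncientLiouville hX ν T hν hT u p hmax hLH hdec
    (hII ν T hν hT u p hmax hLH hdec)

/-- **Load-bearing certificate: route `TypeILiouville` closes from crux #2 and L' (stmt-4050) alone.**
`NavierStokesRegularity` follows from `TypeIliouvilleNoTypeII` and the Type-I Liouville statement L' in
the KNSS gauge, through the proved assembly `TypeILiouville.Assembly_holds`; the persistent half S3 of
the crux `TypeIliouvilleL` is not used. [cite: KochNadirashviliSereginSverak2009, §1 and §6 Prop. 6.1 (arXiv:0709.3599)] -/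
theorem navierStokesRegularity_of_noTypeII_of_typeIAncientLiouville : Summit.NavierStokesRegularity.NavierStokesRegularity.Theses.TypeILiouville.TypeIliouvilleNoTypeII → Summit.NavierStokesRegularity.NavierStokesRegularity.Theses.SymmetryModuliCount.TypeIAncientLiouville → NavierStokesRegularity :=
  fun hII hX =>
    TypeILiouville.Assembly_holds (typeIliouvilleThesis_of_noTypeII_of_typeIAncientLiouville hII hX)

/-- The registered stub `stub_typeIAncientLiouville_knssGauge` of the crux skeleton (signature written
out) IS the item `SymmetryModuliCount.TypeIAncientLiouville` (stmt-NavierStokesRegularity-4050). -/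
theorem stub_typeIAncientLiouville_knssGauge_iff_typeIAncientLiouville :
    (∀ (C : ℝ) (u : ℝ → EuclideanSpace ℝ (Fin 3) → EuclideanSpace ℝ (Fin 3)),
      ContDiffOn ℝ (⊤ : ℕ∞) (Function.uncurry u) (Set.Iio 0 ×ˢ Set.univ) ∧
      (∀ t < 0, Literature.Analysis.FluidPDE.VectorCalculus.IsDivFree (u t)) ∧
      (∀ s t : ℝ, s < t → t < 0 → ∀ x,
        u t x = Literature.Analysis.FluidPDE.heatFlow (u s) (t - s) x -
          ∫ τ in Set.Ioo s t, ∫ y,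
            Literature.Analysis.FluidPDE.oseenKernel (t - τ) (x - y) (u τ y) (u τ y)) ∧
      Literature.Analysis.FluidPDE.HasTypeITimeDecay C u →
      ∀ t < 0, ∀ x, u t x = 0) ↔
    SymmetryModuliCount.TypeIAncientLiouville :=
  Iff.rfl

/-- **Load-bearing certificate, stub form.** `NavierStokesRegularity` from crux #2
`TypeIliouvilleNoTypeII` and the registered stub `stub_typeIAncientLiouville_knssGauge` of the crux
skeleton (signature verbatim); the other registered stub `stub_persistent_backward_L3_decay` is not a
hypothesis. [cite: KochNadirashviliSereginSverak2009, §1 and §6 Prop. 6.1 (arXiv:0709.3599)] -/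
theorem navierStokesRegularity_of_noTypeII_of_stub_typeIAncientLiouville_knssGauge
    (hII : TypeILiouville.TypeIliouvilleNoTypeII)
    (hStub : ∀ (C : ℝ) (u : ℝ → EuclideanSpace ℝ (Fin 3) → EuclideanSpace ℝ (Fin 3)),
      ContDiffOn ℝ (⊤ : ℕ∞) (Function.uncurry u) (Set.Iio 0 ×ˢ Set.univ) ∧
      (∀ t < 0, Literature.Analysis.FluidPDE.VectorCalculus.IsDivFree (u t)) ∧
      (∀ s t : ℝ, s < t → t < 0 → ∀ x,
        u t x = Literature.Analysis.FluidPDE.heatFlow (u s) (t - s) x -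
          ∫ τ in Set.Ioo s t, ∫ y,
            Literature.Analysis.FluidPDE.oseenKernel (t - τ) (x - y) (u τ y) (u τ y)) ∧
      Literature.Analysis.FluidPDE.HasTypeITimeDecay C u →
      ∀ t < 0, ∀ x, u t x = 0) :
    NavierStokesRegularity :=
  navierStokesRegularity_of_noTypeII_of_typeIAncientLiouville hII
    (stub_typeIAncientLiouville_knssGauge_iff_typeIAncientLiouville.1 hStub)

/-- **The route's own chain, discharged, factors through L'.** `NavierStokesRegularity` from crux #2 and
the crux `TypeIliouvilleL` = (L): (L) gives L' (`typeIAncientLiouville_knssGauge_of_TypeIliouvilleL`,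
the Type-I half of the lossless split `TypeIliouvilleL_iff_knssGauge_and_persistentL3`) and the
certificate above concludes — the same conclusion as
`TypeILiouville.closes hII hL typeILiouville_typeIliouvilleLKillsTypeI_proof Assembly_holds`, reached
without the persistent half of (L). [cite: KochNadirashviliSereginSverak2009, §1 and §6 Prop. 6.1 (arXiv:0709.3599)] -/
theorem navierStokesRegularity_of_noTypeII_of_TypeIliouvilleL
    (hII : TypeILiouville.TypeIliouvilleNoTypeII) (hL : TypeILiouville.TypeIliouvilleL) :
    NavierStokesRegularity :=
  navierStokesRegularity_of_noTypeII_of_stub_typeIAncientLiouville_knssGauge hII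
    (typeIAncientLiouville_knssGauge_of_TypeIliouvilleL hL)

end Summit.NavierStokesRegularity.NavierStokesRegularity.Theorems

end
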